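import Summits.AtomisticToContinuum.BoseEinsteinCondensation.Theorems.BECPhaseQuadratureSumRuleSumRuleChainGluePerMode
import Summits.AtomisticToContinuum.BoseEinsteinCondensation.Theorems.BECPhaseQuadratureSumRuleSumRuleChainGlueStructure
import Summits.AtomisticToContinuum.BoseEinsteinCondensation.Theorems.BECPhaseQuadratureSumRuleSumRuleChainGlueLattice
import HarnessLib

/-!
# Route `BECPhaseQuadratureSumRule`, glue `SumRuleChainGlue` (stmt-AtomisticToContinuum-12627) —
# helper: the ultraviolet tail and the infrared window of the mode sum `Σ_{p≠0} T_p`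

With `T_p = ‖a_p a_0Ψ‖²` (`pairOcc`) and the infrared threshold `K₀` (`= Λ√(ρa)` in the glue):

* `uv_tail_le` — `Σ_{‖k_p‖ ≥ K₀} T_p ≤ (N-1) K₀⁻² ∫|∇Ψ|²` (`T_p ≤ (N-1)n_p`, `1 ≤ ‖k_p‖²/K₀²`, the kinetic
  identity `Σ_p ‖k_p‖² n_p = ∫|∇Ψ|²`);
* `tsum_indicator_irWindow_eq_sum` — the crux's indicator-`tsum` over the window `{p ≠ 0, ‖k_p‖ < K₀}` is the
  finite sum over the explicit cube-filter of the `…Lattice` file;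
* `ir_density_le` — `Σ_window ‖ρ_p†Ψ‖² ≤ (64/25) ε N²` from the box second moment bound
  `≤ (1+ε)(ρℓ³)²L³` of `LongWaveStructureBound` with `ℓ = K₀⁻¹` and `N = ρL³` (file `…Structure`: the
  `N²ℓ⁶` terms cancel).
-/

noncomputable section

open MeasureTheory Filter Set
open scoped ENNReal NNReal Topology BigOperators

namespace Summit.AtomisticToContinuum.BoseEinsteinCondensation.Theorems.SumRuleChainGlue

open Literature.MathematicalPhysics.QuantumManyBody.BoseGas

variable {n : ℕ} {L : ℝ}

/-! ### The ultraviolet tail -/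

/-- The tree's wave vector is the route's `k_p = (2π/L)·p`. -/
theorem waveVector_eq_kvec (L : ℝ) (p : Fin 3 → ℤ) : waveVector L p = kvec L p := by
  ext j
  simp [waveVector_apply, kvec, latticeVec]
  ring

/-- **The ultraviolet tail**: `Σ_{‖k_p‖ ≥ K₀} T_p ≤ (N - 1) K₀⁻² ∫_{cell^N} |∇Ψ|²`. -/
theorem uv_tail_le (hL : 0 < L) (Ψ : PeriodicTrialState (n + 2) L) {K₀ : ℝ} (hK₀ : 0 < K₀) :
    ∑' p : Fin 3 → ℤ, {p : Fin 3 → ℤ | K₀ ≤ ‖kvec L p‖}.indicator (fun p => pairOcc L p Ψ.ψ) p ≤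
      ((n + 1 : ℕ) : ℝ≥0∞) * ENNReal.ofReal ((K₀ ^ 2)⁻¹) * ∫⁻ X in cellN (n + 2) L, kineticDensity Ψ.ψ X := by
  have hpt : ∀ p, {p : Fin 3 → ℤ | K₀ ≤ ‖kvec L p‖}.indicator (fun p => pairOcc L p Ψ.ψ) p ≤
      ((n + 1 : ℕ) : ℝ≥0∞) * ENNReal.ofReal ((K₀ ^ 2)⁻¹) *
        (ENNReal.ofReal (‖waveVector L p‖ ^ 2) * momentumOccupation (n + 2) L p Ψ.ψ) := by
    intro p
    by_cases hp : p ∈ {p : Fin 3 → ℤ | K₀ ≤ ‖kvec L p‖}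
    · rw [Set.indicator_of_mem hp, waveVector_eq_kvec]
      have hk : K₀ ≤ ‖kvec L p‖ := hp
      have h1 : 1 ≤ ENNReal.ofReal ((K₀ ^ 2)⁻¹) * ENNReal.ofReal (‖kvec L p‖ ^ 2) := by
        rw [← ENNReal.ofReal_mul (by positivity), ← ENNReal.ofReal_one]
        refine ENNReal.ofReal_le_ofReal ?_
        rw [inv_mul_eq_div, le_div_iff₀ (by positivity), one_mul]
        exact pow_le_pow_left₀ hK₀.le hk 2
      calc pairOcc L p Ψ.ψ ≤ ((n + 1 : ℕ) : ℝ≥0∞) * momentumOccupation (n + 2) L p Ψ.ψ :=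
            pairOcc_le_momentumOccupation hL Ψ p
        _ ≤ ((n + 1 : ℕ) : ℝ≥0∞) * momentumOccupation (n + 2) L p Ψ.ψ *
              (ENNReal.ofReal ((K₀ ^ 2)⁻¹) * ENNReal.ofReal (‖kvec L p‖ ^ 2)) := le_mul_of_one_le_right' h1
        _ = _ := by ring
    · rw [Set.indicator_of_notMem hp]
      exact bot_le
  calc _ ≤ ∑' p : Fin 3 → ℤ, ((n + 1 : ℕ) : ℝ≥0∞) * ENNReal.ofReal ((K₀ ^ 2)⁻¹) *
        (ENNReal.ofReal (‖waveVector L p‖ ^ 2) * momentumOccupation (n + 2) L p Ψ.ψ) := ENNReal.tsum_le_tsum hpt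
    _ = _ := by rw [ENNReal.tsum_mul_left, tsum_normSq_waveVector_mul_momentumOccupation hL Ψ]

/-! ### The infrared window is a finite sum -/

/-- **The indicator-`tsum` over the infrared window is the finite sum over the cube-filter.** -/
theorem tsum_indicator_irWindow_eq_sum (hL : 0 < L) (K₀ : ℝ) (f : (Fin 3 → ℤ) → ℝ≥0∞) :
    ∑' p : Fin 3 → ℤ, {p : Fin 3 → ℤ | p ≠ 0 ∧ ‖kvec L p‖ < K₀}.indicator f p =
      ∑ p ∈ (Fintype.piFinset fun _ : Fin 3 => Finset.Icc (-(⌈L * K₀ / (2 * Real.pi)⌉₊ : ℤ)) ⌈L * K₀ / (2 * Real.pi)⌉₊).filter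
        (fun p => p ≠ 0 ∧ ‖(2 * Real.pi / L) • latticeVec 1 p‖ < K₀), f p := by
  set W := (Fintype.piFinset fun _ : Fin 3 => Finset.Icc (-(⌈L * K₀ / (2 * Real.pi)⌉₊ : ℤ)) ⌈L * K₀ / (2 * Real.pi)⌉₊).filter
    (fun p => p ≠ 0 ∧ ‖(2 * Real.pi / L) • latticeVec 1 p‖ < K₀) with hW
  have hmem : ∀ p, p ∈ {p : Fin 3 → ℤ | p ≠ 0 ∧ ‖kvec L p‖ < K₀} ↔ p ∈ W := by
    intro p
    rw [hW, Finset.mem_filter, Set.mem_setOf_eq]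
    constructor
    · rintro ⟨h1, h2⟩
      exact ⟨mem_box_of_norm_kvec_lt hL h2, h1, h2⟩
    · rintro ⟨-, h1, h2⟩
      exact ⟨h1, h2⟩
  rw [tsum_eq_sum (s := W) fun p hp => Set.indicator_of_notMem (fun h => hp ((hmem p).1 h)) _]
  exact Finset.sum_congr rfl fun p hp => Set.indicator_of_mem ((hmem p).2 hp) _

/-- The cube-filter does not contain `0`. -/
theorem zero_not_mem_irWindow (L K₀ : ℝ) :
    (0 : Fin 3 → ℤ) ∉ (Fintype.piFinset fun _ : Fin 3 => Finset.Icc (-(⌈L * K₀ / (2 * Real.pi)⌉₊ : ℤ)) ⌈L * K₀ / (2 * Real.pi)⌉₊).filter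
        (fun p => p ≠ 0 ∧ ‖(2 * Real.pi / L) • latticeVec 1 p‖ < K₀) := by
  simp [Finset.mem_filter]

/-! ### The infrared density sum -/

/-- **The long-wave structure factor summed over the window**: if the box second moment of
`LongWaveStructureBound` with `ℓ = K₀⁻¹` is `≤ (1+ε)(ρℓ³)²L³` and `N = ρL³`, then
`Σ_{p ≠ 0, ‖k_p‖ < K₀} ‖ρ_p†Ψ‖² ≤ (64/25) ε N²`. -/
theorem ir_density_le (hL : 0 < L) (Ψ : PeriodicTrialState (n + 2) L) {K₀ ρ ε : ℝ} (hK₀ : 0 < K₀) (hℓL : K₀⁻¹ < L)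
    (hε : 0 ≤ ε) (hN : ρ * L ^ 3 = (n + 2 : ℕ))
    (hLW : ∫⁻ u in cell L, ∫⁻ X in cellN (n + 2) L, (∑ j : Fin (n + 2), ∑' m : Fin 3 → ℤ,
        (slidingBox K₀⁻¹ u).indicator (fun _ => (1 : ℝ≥0∞)) (X j + latticeVec L m)) ^ 2 * (‖Ψ.ψ X‖₊ : ℝ≥0∞) ^ 2 ≤
      ENNReal.ofReal ((1 + ε) * (ρ * K₀⁻¹ ^ 3) ^ 2 * L ^ 3)) :
    ∑ p ∈ (Fintype.piFinset fun _ : Fin 3 => Finset.Icc (-(⌈L * K₀ / (2 * Real.pi)⌉₊ : ℤ)) ⌈L * K₀ / (2 * Real.pi)⌉₊).filter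
        (fun p => p ≠ 0 ∧ ‖(2 * Real.pi / L) • latticeVec 1 p‖ < K₀),
        ∫⁻ X in cellN (n + 2) L, (‖densityAmp L p Ψ.ψ X‖₊ : ℝ≥0∞) ^ 2 ≤
      ENNReal.ofReal (64 / 25 * ε * ((n + 2 : ℕ) : ℝ) ^ 2) := by
  set ℓ : ℝ := K₀⁻¹ with hℓ
  have hℓpos : 0 < ℓ := inv_pos.2 hK₀
  set W := (Fintype.piFinset fun _ : Fin 3 => Finset.Icc (-(⌈L * K₀ / (2 * Real.pi)⌉₊ : ℤ)) ⌈L * K₀ / (2 * Real.pi)⌉₊).filter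
    (fun p => p ≠ 0 ∧ ‖(2 * Real.pi / L) • latticeVec 1 p‖ < K₀) with hW
  have hk : ∀ p ∈ W, ‖(2 * Real.pi / L) • latticeVec 1 p‖ * ℓ ≤ 1 := by
    intro p hp
    rw [hW, Finset.mem_filter] at hp
    rw [hℓ, ← div_eq_mul_inv, div_le_one hK₀]
    exact hp.2.2.le
  have hmain := density_sum_le_boxMoment hL hℓpos.le hℓL (zero_not_mem_irWindow L K₀) hk Ψ
  -- the right-hand side is `N²ℓ⁶ + ε N² ℓ⁶`
  have hrhs : ENNReal.ofReal (L ^ 3) * ∫⁻ u in cell L, ∫⁻ X in cellN (n + 2) L, (∑ j : Fin (n + 2), ∑' m : Fin 3 → ℤ,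
      (slidingBox ℓ u).indicator (fun _ => (1 : ℝ≥0∞)) (X j + latticeVec L m)) ^ 2 * (‖Ψ.ψ X‖₊ : ℝ≥0∞) ^ 2 ≤
      ENNReal.ofReal (((n + 2 : ℕ) : ℝ) ^ 2 * ℓ ^ 6) + ENNReal.ofReal (ε * ((n + 2 : ℕ) : ℝ) ^ 2 * ℓ ^ 6) := by
    calc _ ≤ ENNReal.ofReal (L ^ 3) * ENNReal.ofReal ((1 + ε) * (ρ * ℓ ^ 3) ^ 2 * L ^ 3) :=
          mul_le_mul_of_nonneg_left hLW bot_le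
      _ = ENNReal.ofReal (((n + 2 : ℕ) : ℝ) ^ 2 * ℓ ^ 6) + ENNReal.ofReal (ε * ((n + 2 : ℕ) : ℝ) ^ 2 * ℓ ^ 6) := by
          rw [← ENNReal.ofReal_mul (by positivity), ← ENNReal.ofReal_add (by positivity) (by positivity), ← hN]
          congr 1
          ring
  have hle := hmain.trans hrhs
  -- cancel the `N²ℓ⁶` terms and divide by `(25/64)ℓ⁶`
  have hcancel : ENNReal.ofReal (25 / 64 * ℓ ^ 6) *
      ∑ p ∈ W, ∫⁻ X in cellN (n + 2) L, (‖∑ j : Fin (n + 2), cellWave L p (X j) * Ψ.ψ X‖₊ : ℝ≥0∞) ^ 2 ≤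
      ENNReal.ofReal (ε * ((n + 2 : ℕ) : ℝ) ^ 2 * ℓ ^ 6) :=
    (ENNReal.add_le_add_iff_left ENNReal.ofReal_ne_top).1 hle
  have hc0 : ENNReal.ofReal (25 / 64 * ℓ ^ 6) ≠ 0 := by
    rw [Ne, ENNReal.ofReal_eq_zero, not_le]; positivity
  have hcancel' : (∑ p ∈ W, ∫⁻ X in cellN (n + 2) L, (‖∑ j : Fin (n + 2), cellWave L p (X j) * Ψ.ψ X‖₊ : ℝ≥0∞) ^ 2) *
      ENNReal.ofReal (25 / 64 * ℓ ^ 6) ≤ ENNReal.ofReal (ε * ((n + 2 : ℕ) : ℝ) ^ 2 * ℓ ^ 6) := by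
    rw [mul_comm]; exact hcancel
  have hdiv : (∑ p ∈ W, ∫⁻ X in cellN (n + 2) L, (‖∑ j : Fin (n + 2), cellWave L p (X j) * Ψ.ψ X‖₊ : ℝ≥0∞) ^ 2) ≤
      ENNReal.ofReal (ε * ((n + 2 : ℕ) : ℝ) ^ 2 * ℓ ^ 6) / ENNReal.ofReal (25 / 64 * ℓ ^ 6) :=
    (ENNReal.le_div_iff_mul_le (Or.inl hc0) (Or.inl ENNReal.ofReal_ne_top)).2 hcancel'
  refine hdiv.trans (le_of_eq ?_)
  rw [← ENNReal.ofReal_div_of_pos (by positivity)]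
  congr 1
  field_simp

end Summit.AtomisticToContinuum.BoseEinsteinCondensation.Theorems.SumRuleChainGlue

end
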